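import Summits.QuantumAdvantage.QuantumAdvantage.Theorems.SymplecticPurityDeqThesisOneSidedLemmas

/-!
# Crux `DeqThesis` (stmt-QuantumAdvantage-0242), line `Sketch` — stub `stub_oneSidedFlat`

Flatness of the normalised cube graph state `ĝ = (√2ⁿ)⁻¹ Σ_x |x⟩|e((e⁻¹x)³)⟩` on `n + n` qubits
against every locally rotated Pauli string `O = ⊗ₖ Mₖ`, `Mₖ = uₖ σ_{Sₖ} uₖ†` (`S ≠ I`), whenever ONE
of the two registers carries at most `3n/4` non-identity letters: `|⟨ĝ| O |ĝ⟩| ≤ 2^{-n/16}` for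
`n ≥ 32` (any field `K` of order `2ⁿ`, any additive identification `e`, arbitrary complex tilts).

Proof (pairing by the input difference; lemmas in `SymplecticPurityDeqThesisOneSidedLemmas.lean`).
* `⟨ĝ|⊗M|ĝ⟩ = 2^{-n} Σ_{x,x'} A(x,x') B(F x, F x')` with `A = ∏_{i<n} M_i (x_i, x'_i)` (data register),
  `B` likewise on the value register, `F` the cube in coordinates (`graph_dot_tensorAll_mulVec`).
* diagonal `x = x'` (`norm_diag_sum_le`): `Σ_x A(x,x) B(Fx,Fx) = (∏ₖ Mₖ(0,0)) · Σ_x (−1)^{m·x + m'·F(x)}`,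
  a Walsh coefficient of `x³` read through `e`, at most `2 √2ⁿ` (`abs_sum_sign_cube_le`).
* off-diagonal `x' = x ⊕ d`, `d ≠ 0` (`norm_double_sum_le`): `|A(x, x⊕d)| = w_A(d)` is independent
  of `x`, every output difference is hit at most twice (`card_filter_cube_xor_le_two`, APN), and the
  masses `Σ_d w_A(d) = ∏_i (c_i + s_i) ≤ √2^{|S_in|}`, `Σ_t w_B(t) ≤ √2^{|S_out|}`
  (`sum_weight_eq_prod`, `prod_le_sqrt_two_pow`).
* hence `|⟨ĝ|O|ĝ⟩| ≤ 2^{-n} (2 √2ⁿ + 2 √2^{|S_in| + |S_out|}) ≤ 2·2^{-n/2} + 2·2^{-n/8} ≤ 2^{-n/16}`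
  for `n ≥ 32`, using `|S_in| + |S_out| ≤ 3n/4 + n` (`final_bound`).
-/

set_option linter.dupNamespace false -- D-0017: single-problem summit ⇒ `QuantumAdvantage.QuantumAdvantage` by design

namespace Summit.QuantumAdvantage.QuantumAdvantage.Theorems.SymplecticPurity

open Matrix Finset Literature.Computability.QuantumComplexity Literature.Computability.Cryptography

namespace OneSided

/-! ### The diagonal -/


/-- **The diagonal `x = x'`.** If the diagonal entries of the factors are signs times constants of
modulus `≤ 1`, `M_k(b,b) = D_k (−1)^{m_k b}`, with masks `m|_data`, `m|_value` not both zero, then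
`|Σ_x ∏_i M_i(x_i,x_i) ∏_j M_{n+j}((Fx)_j,(Fx)_j)| ≤ 2 √2ⁿ` (a Walsh coefficient of the cube). -/
theorem norm_diag_sum_le {n : ℕ} {K : Type*} [Field K] [Fintype K] (hK : Fintype.card K = 2 ^ n)
    (e : K ≃+ (Fin n → ZMod 2)) (m : Fin (n + n) → ZMod 2)
    (hm : (fun i : Fin n => m (Fin.castAdd n i)) ≠ 0 ∨ (fun j : Fin n => m (Fin.natAdd n j)) ≠ 0)
    (M : Fin (n + n) → Matrix Bool Bool ℂ) (Dg : Fin (n + n) → ℂ) (hD : ∀ k, ‖Dg k‖ ≤ 1)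
    (hMd : ∀ k b, M k b b =
      Dg k * ((if m k * (if b then (1 : ZMod 2) else 0) = 0 then (1 : ℝ) else -1 : ℝ) : ℂ))
    (F : QReg n → QReg n)
    (hF : ∀ x j, F x j = decide (e ((e.symm fun i : Fin n => if x i then 1 else 0) ^ 3) j = 1)) :
    ‖∑ x : QReg n, (∏ i : Fin n, M (Fin.castAdd n i) (x i) (x i)) *
        ∏ j : Fin n, M (Fin.natAdd n j) (F x j) (F x j)‖ ≤ 2 * Real.sqrt 2 ^ n := by
  classical
  have hbit : ∀ x j, (if F x j then (1 : ZMod 2) else 0) =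
      e ((e.symm fun i : Fin n => if x i then 1 else 0) ^ 3) j := by
    intro x j
    rw [hF]
    simp only [decide_eq_true_eq, bit_eq_self]
  simp only [hMd, hbit, Finset.prod_mul_distrib, ← Complex.ofReal_prod, prod_sign_eq,
    mul_mul_mul_comm, ← Finset.mul_sum, ← Complex.ofReal_mul, sign_mul_sign, ← Complex.ofReal_sum]
  rw [norm_mul, Complex.norm_real, Real.norm_eq_abs]
  have hW := abs_sum_sign_cube_le hK e (fun i => m (Fin.castAdd n i)) (fun j => m (Fin.natAdd n j)) hm
  have hP : ‖(∏ i : Fin n, Dg (Fin.castAdd n i)) * ∏ j : Fin n, Dg (Fin.natAdd n j)‖ ≤ 1 := by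
    rw [norm_mul, norm_prod, norm_prod]
    exact mul_le_one₀ (Finset.prod_le_one (fun _ _ => norm_nonneg _) fun _ _ => hD _)
      (Finset.prod_nonneg fun _ _ => norm_nonneg _)
      (Finset.prod_le_one (fun _ _ => norm_nonneg _) fun _ _ => hD _)
  calc _ ≤ 1 * (2 * Real.sqrt 2 ^ n) := mul_le_mul hP hW (abs_nonneg _) zero_le_one
    _ = 2 * Real.sqrt 2 ^ n := one_mul _

/-! ### The estimate -/

/-- **Main estimate.** For the weighted cube graph vector `g = c Σ_x |x⟩|F x⟩` and a locally rotated
Pauli string `O = ⊗ₖ uₖ σ_{Sₖ} uₖ†`, `S ≠ I`: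
`|⟨g| O |g⟩| ≤ |c|² (2 √2ⁿ + 2 √2^{|S_in|} √2^{|S_out|})`. -/
theorem norm_graph_dot_le {n : ℕ} {K : Type*} [Field K] [Fintype K] (hK : Fintype.card K = 2 ^ n)
    (e : K ≃+ (Fin n → ZMod 2)) (u : Fin (n + n) → Matrix Bool Bool ℂ)
    (hu : ∀ i, u i ∈ Matrix.unitaryGroup Bool ℂ) (S : Fin (n + n) → Pauli)
    (hS : S ≠ fun _ => Pauli.I) (F : QReg n → QReg n)
    (hF : ∀ x j, F x j = decide (e ((e.symm fun i : Fin n => if x i then 1 else 0) ^ 3) j = 1))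
    (c : ℂ) :
    ‖star (fun w : QReg (n + n) =>
        if (fun j : Fin n => w (Fin.natAdd n j)) = F (fun i : Fin n => w (Fin.castAdd n i))
        then c else 0) ⬝ᵥ
      (tensorAll (fun i => u i * (S i).mat * star (u i))).mulVec (fun w : QReg (n + n) =>
        if (fun j : Fin n => w (Fin.natAdd n j)) = F (fun i : Fin n => w (Fin.castAdd n i))
        then c else 0)‖ ≤
    ‖c‖ ^ 2 * (2 * Real.sqrt 2 ^ n +
      2 * Real.sqrt 2 ^ (Finset.univ.filter fun i : Fin n => S (Fin.castAdd n i) ≠ Pauli.I).card *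
        Real.sqrt 2 ^ (Finset.univ.filter fun j : Fin n => S (Fin.natAdd n j) ≠ Pauli.I).card) := by
  classical
  obtain ⟨M, hM⟩ : ∃ M : Fin (n + n) → Matrix Bool Bool ℂ, M = fun k => u k * (S k).mat * star (u k) :=
    ⟨_, rfl⟩
  rw [show (fun i => u i * (S i).mat * star (u i)) = M from hM.symm]
  have hMu : ∀ k, M k ∈ Matrix.unitaryGroup Bool ℂ := fun k => by
    rw [hM]
    exact conj_mem_unitaryGroup (hu k) (S k)
  have hMd : ∀ k b, M k b b = M k false false *
      ((if (if S k = Pauli.I then (0 : ZMod 2) else 1) * (if b then (1 : ZMod 2) else 0) = 0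
        then (1 : ℝ) else -1 : ℝ) : ℂ) := fun k b => by
    rw [hM]
    exact conj_apply_diag (hu k) (S k) b
  have hMI : ∀ k, S k = Pauli.I → ‖M k false false‖ + ‖M k false true‖ ≤ 1 := by
    intro k hk
    have h := norm_conj_I (hu k)
    rw [← hk] at h
    rw [hM, h.1, h.2]
    norm_num
  -- masks of the two registers are not both zero
  have h10 : (1 : ZMod 2) ≠ 0 := by decide
  have hm : (fun i : Fin n => (fun k => if S k = Pauli.I then (0 : ZMod 2) else 1) (Fin.castAdd n i)) ≠ 0 ∨
      (fun j : Fin n => (fun k => if S k = Pauli.I then (0 : ZMod 2) else 1) (Fin.natAdd n j)) ≠ 0 := by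
    obtain ⟨k, hk⟩ := Function.ne_iff.1 hS
    revert hk
    refine Fin.addCases
      (motive := fun k => S k ≠ Pauli.I →
        ((fun i : Fin n => (fun k => if S k = Pauli.I then (0 : ZMod 2) else 1) (Fin.castAdd n i)) ≠ 0 ∨
        (fun j : Fin n => (fun k => if S k = Pauli.I then (0 : ZMod 2) else 1) (Fin.natAdd n j)) ≠ 0))
      (fun i hi => Or.inl fun h0 => ?_) (fun j hj => Or.inr fun h0 => ?_) k
    · have h1 := congrFun h0 i
      simp only [Pi.zero_apply, hi, if_false] at h1
      exact h10 h1
    · have h1 := congrFun h0 j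
      simp only [Pi.zero_apply, hj, if_false] at h1
      exact h10 h1
  -- total masses of the product weights
  have hWA : ∑ d : QReg n, ∏ i : Fin n,
      (if d i then ‖M (Fin.castAdd n i) false true‖ else ‖M (Fin.castAdd n i) false false‖) ≤
      Real.sqrt 2 ^ (Finset.univ.filter fun i : Fin n => S (Fin.castAdd n i) ≠ Pauli.I).card := by
    rw [sum_weight_eq_prod (fun i => ‖M (Fin.castAdd n i) false false‖)
      (fun i => ‖M (Fin.castAdd n i) false true‖)]
    refine prod_le_sqrt_two_pow _ _ (fun i => by positivity)
      (fun i => norm_add_norm_le_sqrt_two (hMu _)) fun i hi => hMI _ ?_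
    simpa using hi
  have hWB : ∑ t : QReg n, ∏ j : Fin n,
      (if t j then ‖M (Fin.natAdd n j) false true‖ else ‖M (Fin.natAdd n j) false false‖) ≤
      Real.sqrt 2 ^ (Finset.univ.filter fun j : Fin n => S (Fin.natAdd n j) ≠ Pauli.I).card := by
    rw [sum_weight_eq_prod (fun j => ‖M (Fin.natAdd n j) false false‖)
      (fun j => ‖M (Fin.natAdd n j) false true‖)]
    refine prod_le_sqrt_two_pow _ _ (fun j => by positivity)
      (fun j => norm_add_norm_le_sqrt_two (hMu _)) fun j hj => hMI _ ?_
    simpa using hj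
  -- the expansion and the pairing estimate
  rw [graph_dot_tensorAll_mulVec F M c _ rfl, norm_mul, norm_mul, norm_star, ← sq]
  refine mul_le_mul_of_nonneg_left ?_ (sq_nonneg _)
  refine (norm_double_sum_le
    (fun x x' => ∏ i : Fin n, M (Fin.castAdd n i) (x i) (x' i))
    (fun y y' => ∏ j : Fin n, M (Fin.natAdd n j) (y j) (y' j)) F
    (fun d => ∏ i : Fin n,
      (if d i then ‖M (Fin.castAdd n i) false true‖ else ‖M (Fin.castAdd n i) false false‖))
    (fun t => ∏ j : Fin n,
      (if t j then ‖M (Fin.natAdd n j) false true‖ else ‖M (Fin.natAdd n j) false false‖))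
    (2 * Real.sqrt 2 ^ n)
    (Real.sqrt 2 ^ (Finset.univ.filter fun j : Fin n => S (Fin.natAdd n j) ≠ Pauli.I).card)
    (fun x x' => (norm_prod_entry (fun i => M (Fin.castAdd n i)) (fun i => hMu _) x x').le)
    (fun y y' => (norm_prod_entry (fun j => M (Fin.natAdd n j)) (fun j => hMu _) y y').le)
    (fun d => Finset.prod_nonneg fun i _ => by positivity)
    (fun t => Finset.prod_nonneg fun j _ => by positivity)
    (norm_diag_sum_le hK e (fun k => if S k = Pauli.I then (0 : ZMod 2) else 1) hm M
      (fun k => M k false false) (fun k => entry_norm_bound_of_unitary (hMu k) _ _) hMd F hF)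
    (card_filter_cube_xor_le_two hK e F hF) hWB).trans ?_
  have h0 : 0 ≤ Real.sqrt 2 ^ (Finset.univ.filter fun j : Fin n => S (Fin.natAdd n j) ≠ Pauli.I).card := by
    positivity
  nlinarith

/-- **Final arithmetic**: `2^{-n} (2 √2ⁿ + 2 √2^a √2^b) ≤ 2^{-n/16}` for `n ≥ 32`, `a, b ≤ n`,
`4 min(a,b) ≤ 3n`. -/
theorem final_bound (n a b : ℕ) (hn : 32 ≤ n) (ha : a ≤ n) (hb : b ≤ n) (hmin : 4 * min a b ≤ 3 * n) :
    ‖((Real.sqrt 2 : ℂ) ^ n)⁻¹‖ ^ 2 * (2 * Real.sqrt 2 ^ n + 2 * Real.sqrt 2 ^ a * Real.sqrt 2 ^ b) ≤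
      (2 : ℝ) ^ (-(1 / 16 * (n : ℝ))) := by
  have hab : 4 * (a + b) ≤ 7 * n := by
    rcases le_total a b with h | h
    · rw [min_eq_left h] at hmin
      omega
    · rw [min_eq_right h] at hmin
      omega
  have h2 : (0 : ℝ) < 2 := by norm_num
  have hpow : ∀ m : ℕ, Real.sqrt 2 ^ m = (2 : ℝ) ^ ((m : ℝ) / 2) := by
    intro m
    rw [Real.sqrt_eq_rpow, ← Real.rpow_natCast, ← Real.rpow_mul h2.le]
    congr 1
    ring
  have hnorm : ‖((Real.sqrt 2 : ℂ) ^ n)⁻¹‖ ^ 2 = (2 : ℝ) ^ (-(n : ℝ)) := by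
    rw [norm_inv, norm_pow, Complex.norm_real, Real.norm_of_nonneg (Real.sqrt_nonneg _), inv_pow,
      ← pow_mul, pow_mul', Real.sq_sqrt h2.le, Real.rpow_neg h2.le, Real.rpow_natCast]
  have hab' : ((a : ℝ) + b) / 2 ≤ 7 * n / 8 := by
    have h := (Nat.cast_le (α := ℝ)).2 hab
    push_cast at h
    linarith
  have hn' : (32 : ℝ) ≤ n := by exact_mod_cast hn
  rw [hnorm, hpow n, hpow a, hpow b]
  calc (2 : ℝ) ^ (-(n : ℝ)) * (2 * 2 ^ ((n : ℝ) / 2) + 2 * 2 ^ ((a : ℝ) / 2) * 2 ^ ((b : ℝ) / 2))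
      = 2 * 2 ^ (-(n : ℝ) + n / 2) + 2 * 2 ^ (-(n : ℝ) + a / 2 + b / 2) := by
        rw [Real.rpow_add h2, Real.rpow_add h2, Real.rpow_add h2]
        ring
    _ ≤ 2 * 2 ^ (-(n : ℝ) / 8) + 2 * 2 ^ (-(n : ℝ) / 8) := by
        have e1 : (2 : ℝ) ^ (-(n : ℝ) + n / 2) ≤ 2 ^ (-(n : ℝ) / 8) :=
          Real.rpow_le_rpow_of_exponent_le one_le_two (by linarith)
        have e2 : (2 : ℝ) ^ (-(n : ℝ) + a / 2 + b / 2) ≤ 2 ^ (-(n : ℝ) / 8) :=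
          Real.rpow_le_rpow_of_exponent_le one_le_two (by linarith)
        linarith
    _ = 2 ^ ((2 : ℝ) + -(n : ℝ) / 8) := by
        rw [Real.rpow_add h2, Real.rpow_two]
        ring
    _ ≤ 2 ^ (-(1 / 16 * (n : ℝ))) := Real.rpow_le_rpow_of_exponent_le one_le_two (by linarith)

end OneSided

/-- **Stub `stub_oneSidedFlat`** of the line `Sketch` of crux `DeqThesis` (stmt-QuantumAdvantage-0242):
the normalised cube graph state is `2^{-n/16}`-flat (for `n ≥ 32`) against every locally rotated
Pauli string `⊗ₖ uₖ σ_{Sₖ} uₖ†`, `S ≠ I`, whenever one register carries at most `3n/4` non-identity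
letters (`4 · min(|S_in|, |S_out|) ≤ 3 n`) — for every field `K` of order `2ⁿ`, every additive
identification `e`, and arbitrary one-qubit unitaries `uₖ`. Pairing `x' = x ⊕ d`: the diagonal is a
Walsh coefficient of `x³` (near-bentness, `≤ 2√2ⁿ`), and each off-diagonal class is controlled by
almost perfect nonlinearity and the `ℓ¹`-masses `∏ (cₖ + sₖ) ≤ √2^{|supp|}` of the two registers. -/
theorem stub_oneSidedFlat :
    ∃ δ : ℝ, 0 < δ ∧ ∃ n₀ : ℕ, ∀ n ≥ n₀, ∀ (K : Type) [Field K] [Fintype K], Fintype.card K = 2 ^ n →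
      ∀ e : K ≃+ (Fin n → ZMod 2),
      ∀ u : Fin (n + n) → Matrix Bool Bool ℂ, (∀ i, u i ∈ Matrix.unitaryGroup Bool ℂ) →
        ∀ S : Fin (n + n) → Pauli, S ≠ (fun _ => Pauli.I) →
          (4 * min (Finset.univ.filter (fun i : Fin n => S (Fin.castAdd n i) ≠ Pauli.I)).card
              (Finset.univ.filter (fun j : Fin n => S (Fin.natAdd n j) ≠ Pauli.I)).card ≤ 3 * n) →
          ‖star (fun w : QReg (n + n) =>
                if (fun j : Fin n => w (Fin.natAdd n j)) =
                    (fun j : Fin n => decide (e ((e.symm (fun i : Fin n => if w (Fin.castAdd n i) then 1 else 0)) ^ 3) j = 1))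
                then ((Real.sqrt 2 ^ n)⁻¹ : ℂ) else 0) ⬝ᵥ
              (tensorAll (fun i => u i * (S i).mat * star (u i))).mulVec
                (fun w : QReg (n + n) =>
                  if (fun j : Fin n => w (Fin.natAdd n j)) =
                      (fun j : Fin n => decide (e ((e.symm (fun i : Fin n => if w (Fin.castAdd n i) then 1 else 0)) ^ 3) j = 1))
                  then ((Real.sqrt 2 ^ n)⁻¹ : ℂ) else 0)‖
            ≤ (2 : ℝ) ^ (-(δ * (n : ℝ))) := by
  refine ⟨1 / 16, by norm_num, 32, ?_⟩
  intro n hn K _ _ hK e u hu S hS hmin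
  refine le_trans (OneSided.norm_graph_dot_le hK e u hu S hS
    (fun x j => decide (e ((e.symm fun i : Fin n => if x i then 1 else 0) ^ 3) j = 1))
    (fun x j => rfl) _) ?_
  exact OneSided.final_bound n _ _ hn ((Finset.card_filter_le _ _).trans (by simp))
    ((Finset.card_filter_le _ _).trans (by simp)) hmin

end Summit.QuantumAdvantage.QuantumAdvantage.Theorems.SymplecticPurity
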